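import Literature.Analysis.InnerProduct.HigherLensSpaceMultiplicityInvariance
import Literature.Analysis.InnerProduct.IkedaIsospectralLensSpaces
import HarnessLib

/-!
# Ikeda's Theorem 3.1 (i) for EVERY prime `q ≥ 11`: two `(q − 6)`-dimensional lens spaces with fundamental group `ℤ_q` which are
# isospectral but not isometric — the complements of `(1, 2)` and `(1, 3)` in a full system of residues

Layer `Literature/Analysis/InnerProduct`, namespace `Literature.Analysis.InnerProduct`; lane `lit-hodgefound`, prover seat
`lit-hodgefound-p06`, generation 44, self-proposed row g44-#13 — the sequel BY IMPORT of rows g44-#12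
(`HigherLensSpaceMultiplicityInvariance.lean`: `LensWeightsEquivalent.isCoprime`) and g44-#3 (`IkedaIsospectralLensSpaces.lean`: the
complement trick `IsIkedaWeights.exists_append`/`append_right`/`intCast_injective`/`intCast_ne_neg`/`intCast_ne_zero` and THEOREM 3.1 (i)
in the form "all of `𝓛̃₀(q, q₀ − 2)` is mutually isospectral", `IsIkedaWeights.lensSpaceMultiplicity_eq_of_eq_two_mul_add_seven`). Row g44-#3
exhibited non-isometric isospectral pairs only for `q = 11` (and g44-#4 for `q = 13`); Ikeda's Theorem 3.1 (i) asserts their existence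
for EVERY prime `q ≥ 11` by counting (`|𝓛₀(q, n)| ≥ (1/n)·C(q₀−1, n−1) > 1 = |J(q, 2)|`). This file proves the existence statement for
every prime `q ≥ 11` with an explicit witness in place of the count: the complements `ω(1, 2)` and `ω(1, 3)`. THEOREMS ONLY (no
definition, no instance, no notation, no named fact).

## Source, verbatim (held text `paper:doi-10-24033-asens-1384`, pp. 304–305 = p0003–p0004, p. 311 = p0010)

A. Ikeda, *On lens spaces which are isospectral but not isometric*, Ann. Sci. ÉNS (4) **13** (1980) 303–315: (1.2)–(1.3) "we choose an
element `(q₁, …, q_k) ∈ Ĩ₀(q, k)` such that the set of integers `{p₁, −p₁, …, p_n, −p_n, q₁, −q₁, …, q_k, −q_k}` forms a complete set of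
incongruent residues prime to `q`. … the map `ω` is a bijection of `𝓛₀(q, n)` onto `𝓛₀(q, k)`" (Proposition 1.1); "**THEOREM 3.1.** (i)
let `q` be a prime not less than `11`. Then there exist at least two `(q − 6)`-dimensional lens spaces with fundamental groups of order
`q` which are isospectral but not isometric; … *Proof.* (i) let `q` be a prime with `q ≥ 11`. Then `q₀ = φ(q)/2 = (q−1)/2 ≥ 5`. Put `k = 2`
and `n = q₀ − 2`. Then `2n − 1 = q − 6`. To prove (i), it suffices to show that the map `ω̃₂` is not injective. By Proposition 2.4 and
Corollary 1.3, we have `|𝓛₀(q, n)| ≥ … > 1 = |J(q, 2)|` …"; "*Remark.* By Theorem 2.1, these lens spaces, which are isospectral but not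
isometric, are neither diffeomorphic nor homeomorphic to each other." (p0010–p0011).

## The proof as formalised (explicit witnesses instead of the count)

§1: a full system `F ∈ Ĩ₀(q, h)`, `q = 2h + 1`, has `2h = q − 1` pairwise distinct nonzero residues `±Fᵢ`, hence all of them
(`Finset.eq_of_subset_of_card_le`, as in row g44-#3). §2: if `(a, p)` and `(a′, p′)` are full and `p_{σ(j)} ≡ ε_j l p′_j`, then for each
`i` the nonzero residue `l·a′ᵢ` is `±a_j` or `±p_j`; the latter would give `a′ᵢ ≡ ±p′_{σ⁻¹(j)}` (cancel the unit `l`), impossible inside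
the Ikeda system `(a′, p′)`; so `l·a′ᵢ = ±a_{τ(i)}` with `τ` injective (again by the Ikeda conditions on `a′`), hence a permutation
(`Finite.injective_iff_bijective`), i.e. `a ∼ a′`. §3: `(1, 2), (1, 3) ∈ Ĩ₀(q, 2)` (`q ≥ 5`), and an equivalence `(1, 2) ∼ (1, 3)` mod `q`
forces `q ∣ v_{σ(1)} − 3ε₀ε₁v_{σ(0)} ∈ {−1, 5, −5, 7}`, impossible for `q ≥ 11` (`decide` over `Perm (Fin 2)`). §4: `q = 2(n+3) + 1`;
complete `(1, 2)` and `(1, 3)` to full systems `((1, 2), ω)`, `((1, 3), ω′)` (`exists_append`); `ω, ω′ ∈ Ĩ₀(q, n + 1)` are isospectral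
(THEOREM 3.1 (i) of row g44-#3) and not equivalent (§2 + §3).

## What is proved

* §1 **`IsIkedaWeights.exists_eq_or_eq_neg`** (a full system covers every nonzero residue up to sign).
* §2 **`LensWeightsEquivalent.of_append`** (equivalence passes to complements — `ω` injective on classes).
* §3 `isIkedaWeights_one_two`, `isIkedaWeights_one_three`, **`not_lensWeightsEquivalent_one_two_one_three`** (`|𝓛₀(q, 2)| ≥ 2`).
* §4 **`exists_isospectral_not_lensWeightsEquivalent`** — THEOREM 3.1 (i) for every prime `q ≥ 11`.

## References

* [Ikeda1980] A. Ikeda, *On lens spaces which are isospectral but not isometric*, Ann. Sci. ÉNS (4) 13 (1980) 303–315, §1 (1.1)–(1.3),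
  Proposition 1.1, Corollary 1.3, §2 Theorem 2.1, Proposition 2.4, §3 Theorem 3.1 (i) and Remark.
* [IkedaYamamoto1979] A. Ikeda, Y. Yamamoto, *On the spectra of 3-dimensional lens spaces*, Osaka J. Math. 16 (1979) 447–469,
  Proposition 1.1 (equivalent weights give isometric lens spaces).
-/

noncomputable section

namespace Literature.Analysis.InnerProduct

open Finset
open _root_.Real

variable {q : ℕ} [hq : Fact q.Prime]

/-! ### §1 A full system `(F₁, …, F_h) ∈ Ĩ₀(q, h)`, `q = 2h+1`: every nonzero residue is `±Fᵢ` -/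

/-- **A full system exhausts the nonzero residues up to sign**: for `(F₁, …, F_h) ∈ Ĩ₀(q, h)` with `q = 2h + 1` an odd prime, every
nonzero residue mod `q` is `±Fᵢ` for some `i` ("the set of integers `{p₁, −p₁, …, p_n, −p_n, q₁, −q₁, …, q_k, −q_k}` forms a complete
set of incongruent residues prime to `q`"). [cite: Ikeda1980, §1 (1.2)–(1.3)] -/
theorem IsIkedaWeights.exists_eq_or_eq_neg (hq2 : q ≠ 2) {h : ℕ} {F : Fin h → ℤ} (hF : IsIkedaWeights q F) (hh : 2 * h + 1 = q)
    {r : ZMod q} (hr : r ≠ 0) : ∃ i, r = ((F i : ℤ) : ZMod q) ∨ r = -((F i : ℤ) : ZMod q) := by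
  classical
  let ρ : Fin h ⊕ Fin h → ZMod q := fun s ↦ Sum.elim (fun i ↦ ((F i : ℤ) : ZMod q)) (fun i ↦ -((F i : ℤ) : ZMod q)) s
  have hρ : Function.Injective ρ := by
    rintro (i | i) (j | j) hij
    · exact congrArg Sum.inl (hF.intCast_injective hij)
    · exact absurd hij (hF.intCast_ne_neg hq2 i j)
    · exact absurd hij.symm (hF.intCast_ne_neg hq2 j i)
    · exact congrArg Sum.inr (hF.intCast_injective (neg_injective hij))
  have himage : (Finset.univ : Finset (Fin h ⊕ Fin h)).image ρ = (Finset.univ : Finset (ZMod q)).erase 0 := by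
    apply Finset.eq_of_subset_of_card_le
    · intro r hr
      obtain ⟨s, -, rfl⟩ := Finset.mem_image.mp hr
      rw [Finset.mem_erase]
      refine ⟨?_, Finset.mem_univ _⟩
      rcases s with i | i
      · exact hF.intCast_ne_zero i
      · exact neg_ne_zero.mpr (hF.intCast_ne_zero i)
    · rw [Finset.card_erase_of_mem (Finset.mem_univ _), Finset.card_univ, ZMod.card,
        Finset.card_image_of_injective _ hρ, Finset.card_univ, Fintype.card_sum, Fintype.card_fin]
      omega
  have hr' : r ∈ (Finset.univ : Finset (ZMod q)).erase 0 := Finset.mem_erase.mpr ⟨hr, Finset.mem_univ _⟩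
  rw [← himage, Finset.mem_image] at hr'
  obtain ⟨s, -, hs⟩ := hr'
  rcases s with i | i
  · exact ⟨i, Or.inl hs.symm⟩
  · exact ⟨i, Or.inr hs.symm⟩

/-! ### §2 Equivalence passes to complements -/

/-- A unit mod `q` in `ℤ` is a unit of `ZMod q`. [folklore] -/
private theorem intCast_ne_zero_of_isCoprime {l : ℤ} (hl : IsCoprime l q) : ((l : ℤ) : ZMod q) ≠ 0 := by
  obtain ⟨u, v, huv⟩ := hl
  intro h0
  have h1 : (((u * l + v * q : ℤ)) : ZMod q) = 1 := by rw [huv]; simp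
  push_cast at h1
  rw [h0, ZMod.natCast_self, mul_zero, mul_zero, add_zero] at h1
  exact zero_ne_one h1

/-- **Equivalence passes to complementary weights** (the map `ω` of (1.3) is well defined on classes and injective: "`ω(𝓛₀(q, n)) =
𝓛₀(q, k)`"): if `(a, p), (a′, p′) ∈ Ĩ₀(q, h)` are full systems (`q = 2h + 1` an odd prime) and `p ∼ p′` (a number `l`, signs `εᵢ`, a
permutation), then `a ∼ a′` — multiplication by the unit `l` permutes the `±`-classes, carries `{±p′ⱼ}` onto `{±pⱼ}`, hence the
complement `{±a′ᵢ}` onto the complement `{±aᵢ}`. [cite: Ikeda1980, §1 (1.2)–(1.3) and Proposition 1.1 (`ω` is a bijection of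
`𝓛₀(q, n)` onto `𝓛₀(q, k)`)] -/
theorem LensWeightsEquivalent.of_append (hq2 : q ≠ 2) {h n k : ℕ} (hh : 2 * h + 1 = q) (hk : n + (k + 1) = h)
    {a a' : Fin n → ℤ} {p p' : Fin (k + 1) → ℤ} (hF : IsIkedaWeights q (Fin.append a p))
    (hF' : IsIkedaWeights q (Fin.append a' p')) (hpp : LensWeightsEquivalent q p p') : LensWeightsEquivalent q a a' := by
  classical
  obtain ⟨l, hl, e, he, σ, hσ⟩ := hpp.isCoprime hF.append_right.isCoprime
  have hσ' : ∀ j, ((p (σ j) : ℤ) : ZMod q) = ((e j : ℤ) : ZMod q) * ((l : ℤ) : ZMod q) * ((p' j : ℤ) : ZMod q) := fun j ↦ by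
    have := (ZMod.intCast_eq_intCast_iff _ _ _).mpr (hσ j)
    push_cast at this
    exact this
  have hl0 : ((l : ℤ) : ZMod q) ≠ 0 := intCast_ne_zero_of_isCoprime hl
  have he' : ∀ j, ((e j : ℤ) : ZMod q) = 1 ∨ ((e j : ℤ) : ZMod q) = -1 := fun j ↦ by
    rcases he j with h1 | h1 <;> simp [h1]
  -- each `l·a′ᵢ` is `±a_j` for some `j`
  have hex : ∀ i : Fin n, ∃ j : Fin n, ((l : ℤ) : ZMod q) * ((a' i : ℤ) : ZMod q) = ((a j : ℤ) : ZMod q) ∨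
      ((l : ℤ) : ZMod q) * ((a' i : ℤ) : ZMod q) = -((a j : ℤ) : ZMod q) := by
    intro i
    have hr : ((l : ℤ) : ZMod q) * ((a' i : ℤ) : ZMod q) ≠ 0 :=
      mul_ne_zero hl0 (by simpa only [Fin.append_left] using hF'.intCast_ne_zero (Fin.castAdd (k + 1) i))
    obtain ⟨j, hj⟩ := hF.exists_eq_or_eq_neg hq2 (hk ▸ hh) hr
    revert hj
    refine Fin.addCases (fun j₁ hj ↦ ⟨j₁, by simpa only [Fin.append_left] using hj⟩) (fun j₂ hj ↦ ?_) j
    -- the case `l·a′ᵢ = ±p_{j₂}` is impossible: `p_{j₂} = e·l·p′_{σ⁻¹ j₂}` would give `a′ᵢ ≡ ±p′_{σ⁻¹ j₂}`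
    exfalso
    simp only [Fin.append_right] at hj
    set j₃ := σ.symm j₂ with hj₃
    have hp2 : ((p j₂ : ℤ) : ZMod q) = ((e j₃ : ℤ) : ZMod q) * ((l : ℤ) : ZMod q) * ((p' j₃ : ℤ) : ZMod q) := by
      have := hσ' j₃
      rwa [hj₃, Equiv.apply_symm_apply] at this
    have hidx : (Fin.castAdd (k + 1) i : Fin (n + (k + 1))) ≠ Fin.natAdd n j₃ := fun hc ↦ by
      have := congrArg Fin.val hc
      simp at this
      omega
    have hne := hF'.intCast_injective.ne hidx
    have hne' := hF'.intCast_ne_neg hq2 (Fin.castAdd (k + 1) i) (Fin.natAdd n j₃)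
    simp only [Fin.append_left, Fin.append_right] at hne hne'
    rcases hj with hj | hj <;> rcases he' j₃ with h3 | h3
    · exact hne (mul_left_cancel₀ hl0 (by rw [hj, hp2, h3]; ring))
    · exact hne' (mul_left_cancel₀ hl0 (by rw [hj, hp2, h3]; ring))
    · exact hne' (mul_left_cancel₀ hl0 (by rw [mul_neg, hj, hp2, h3]; ring))
    · exact hne (mul_left_cancel₀ hl0 (by rw [← neg_neg (((l : ℤ) : ZMod q) * _), hj, hp2, h3]; ring))
  choose τ hτ using hex
  have hτinj : Function.Injective τ := by
    intro i i' hii'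
    by_contra hne0
    have h1 := hτ i
    have h2 := hτ i'
    rw [hii'] at h1
    have hidx : (Fin.castAdd (k + 1) i : Fin (n + (k + 1))) ≠ Fin.castAdd (k + 1) i' := fun hc ↦ hne0 (Fin.castAdd_inj.mp hc)
    have hA := hF'.intCast_injective.ne hidx
    have hA' := hF'.intCast_ne_neg hq2 (Fin.castAdd (k + 1) i) (Fin.castAdd (k + 1) i')
    simp only [Fin.append_left] at hA hA'
    rcases h1 with h1 | h1 <;> rcases h2 with h2 | h2
    · exact hA (mul_left_cancel₀ hl0 (h1.trans h2.symm))
    · exact hA' (mul_left_cancel₀ hl0 (by rw [mul_neg, h1, h2, neg_neg]))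
    · exact hA' (mul_left_cancel₀ hl0 (by rw [mul_neg, h1, h2]))
    · exact hA (mul_left_cancel₀ hl0 (h1.trans h2.symm))
  have hτbij : Function.Bijective τ := Finite.injective_iff_bijective.mp hτinj
  refine ⟨l, fun i ↦ if ((l : ℤ) : ZMod q) * ((a' i : ℤ) : ZMod q) = ((a (τ i) : ℤ) : ZMod q) then 1 else -1,
    fun i ↦ by dsimp only; split_ifs <;> simp, Equiv.ofBijective τ hτbij, fun i ↦ ?_⟩
  rw [Equiv.ofBijective_apply]
  dsimp only
  split_ifs with hc
  · refine (ZMod.intCast_eq_intCast_iff _ _ _).mp ?_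
    push_cast
    rw [← hc]
    ring
  · rcases hτ i with h1 | h1
    · exact absurd h1 hc
    · refine (ZMod.intCast_eq_intCast_iff _ _ _).mp ?_
      push_cast
      rw [← neg_neg (((a (τ i)) : ℤ) : ZMod q), ← h1]
      ring

/-! ### §3 `(1, 2), (1, 3) ∈ Ĩ₀(q, 2)` are not equivalent for a prime `q ≥ 11` -/

omit hq in
/-- `q ∤ m` for `0 < |m| < q`. [folklore] -/
private theorem not_dvd_of_abs_lt {m : ℤ} (hm : m ≠ 0) (hlt : |m| < q) : ¬((q : ℤ) ∣ m) := fun hd ↦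
  hm (Int.eq_zero_of_abs_lt_dvd hd hlt)

/-- An integer `r` with `1 ≤ r ≤ q − 1` is prime to the prime `q`. [folklore] -/
private theorem isCoprime_of_pos_of_lt' {r : ℤ} (h1 : 1 ≤ r) (h2 : r < q) : IsCoprime r q := by
  lift r to ℕ using (by omega : 0 ≤ r)
  rw [Nat.isCoprime_iff_coprime]
  exact ((Nat.Prime.coprime_iff_not_dvd hq.out).mpr (Nat.not_dvd_of_pos_of_lt (by omega) (by omega))).symm

/-- `(1, 2) ∈ Ĩ₀(q, 2)` for a prime `q ≥ 5`. [cite: Ikeda1980, §1 (1.1)] -/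
theorem isIkedaWeights_one_two (hq5 : 5 ≤ q) : IsIkedaWeights q ![1, 2] where
  isCoprime i := by
    have hq' : (5 : ℤ) ≤ q := by exact_mod_cast hq5
    fin_cases i
    · exact isCoprime_of_pos_of_lt' (by norm_num) (by simp; linarith)
    · exact isCoprime_of_pos_of_lt' (by simp) (by simp; linarith)
  not_dvd_sub i j hij := by
    have hq' : (5 : ℤ) ≤ q := by exact_mod_cast hq5
    fin_cases i <;> fin_cases j
    · exact absurd rfl hij
    · exact not_dvd_of_abs_lt (by simp) (by simp; linarith)
    · exact not_dvd_of_abs_lt (by simp) (by simp; linarith)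
    · exact absurd rfl hij
  not_dvd_add i j hij := by
    have hq' : (5 : ℤ) ≤ q := by exact_mod_cast hq5
    fin_cases i <;> fin_cases j
    · exact absurd rfl hij
    · exact not_dvd_of_abs_lt (by simp) (by simp; linarith)
    · exact not_dvd_of_abs_lt (by simp) (by simp; linarith)
    · exact absurd rfl hij

/-- `(1, 3) ∈ Ĩ₀(q, 2)` for a prime `q ≥ 5`. [cite: Ikeda1980, §1 (1.1)] -/
theorem isIkedaWeights_one_three (hq5 : 5 ≤ q) : IsIkedaWeights q ![1, 3] where
  isCoprime i := by
    have hq' : (5 : ℤ) ≤ q := by exact_mod_cast hq5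
    fin_cases i
    · exact isCoprime_of_pos_of_lt' (by norm_num) (by simp; linarith)
    · exact isCoprime_of_pos_of_lt' (by simp) (by simp; linarith)
  not_dvd_sub i j hij := by
    have hq' : (5 : ℤ) ≤ q := by exact_mod_cast hq5
    fin_cases i <;> fin_cases j
    · exact absurd rfl hij
    · exact not_dvd_of_abs_lt (by simp) (by simp; linarith)
    · exact not_dvd_of_abs_lt (by simp) (by simp; linarith)
    · exact absurd rfl hij
  not_dvd_add i j hij := by
    have hq' : (5 : ℤ) ≤ q := by exact_mod_cast hq5
    fin_cases i <;> fin_cases j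
    · exact absurd rfl hij
    · exact not_dvd_of_abs_lt (by simp) (by simp; linarith)
    · exact not_dvd_of_abs_lt (by simp) (by simp; linarith)
    · exact absurd rfl hij

omit hq in
/-- **`(1, 2)` and `(1, 3)` are not equivalent in `Ĩ₀(q, 2)` for `q ≥ 11`** (so `|𝓛₀(q, 2)| ≥ 2 > 1 = |J(q, 2)|`, the inequality
driving Theorem 3.1 (i)): an equivalence would force `q ∣ 2 ∓ 3` or `q ∣ 1 ∓ 6`, i.e. `q ∣ 1, 5` or `7`. [cite: Ikeda1980, proof of
Theorem 3.1 (i) ("`|𝓛₀(q, n)| ≥ … > 1 = |J(q, 2)|`") with Proposition 2.4 and Corollary 1.3] -/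
theorem not_lensWeightsEquivalent_one_two_one_three (hq11 : 11 ≤ q) : ¬LensWeightsEquivalent q ![1, 2] ![1, 3] := by
  rintro ⟨l, e, he, σ, hσ⟩
  have hq' : (11 : ℤ) ≤ q := by exact_mod_cast hq11
  have h0 := hσ 0
  have h1 := hσ 1
  simp only [Matrix.cons_val_zero, Matrix.cons_val_one, mul_one] at h0 h1
  -- `v(σ1) − 3·e₀e₁·v(σ0) ≡ 0`
  have hkey : (q : ℤ) ∣ (![1, 2] : Fin 2 → ℤ) (σ 1) - 3 * (e 0 * e 1) * (![1, 2] : Fin 2 → ℤ) (σ 0) := by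
    have hsq : e 0 * e 0 = 1 := by rcases he 0 with h | h <;> simp [h]
    have d0 := Int.modEq_iff_dvd.mp h0.symm
    have d1 := Int.modEq_iff_dvd.mp h1.symm
    have : (![1, 2] : Fin 2 → ℤ) (σ 1) - 3 * (e 0 * e 1) * (![1, 2] : Fin 2 → ℤ) (σ 0) =
        ((![1, 2] : Fin 2 → ℤ) (σ 1) - e 1 * l * 3) - 3 * e 0 * e 1 * ((![1, 2] : Fin 2 → ℤ) (σ 0) - e 0 * l)
          - 3 * e 1 * l * (e 0 * e 0 - 1) := by ring
    rw [this, hsq, sub_self, mul_zero, sub_zero]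
    exact dvd_sub d1 (dvd_mul_of_dvd_right d0 _)
  have hperm : ∀ s : Equiv.Perm (Fin 2), (s 0 = 0 ∧ s 1 = 1) ∨ (s 0 = 1 ∧ s 1 = 0) := by decide
  have hee : e 0 * e 1 = 1 ∨ e 0 * e 1 = -1 := by
    rcases he 0 with h | h <;> rcases he 1 with h' | h' <;> simp [h, h']
  rcases hperm σ with ⟨hs0, hs1⟩ | ⟨hs0, hs1⟩ <;> rcases hee with hp | hp <;>
    simp only [hs0, hs1, hp, Matrix.cons_val_zero, Matrix.cons_val_one] at hkey <;>
    exact not_dvd_of_abs_lt (by norm_num) (lt_of_lt_of_le (by norm_num) hq') hkey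

/-! ### §4 THEOREM 3.1 (i): for every prime `q ≥ 11` two `(q − 6)`-dimensional lens spaces, isospectral, not isometric -/

/-- **IKEDA'S THEOREM 3.1 (i), FOR EVERY PRIME `q ≥ 11`**: "let `q` be a prime not less than `11`. Then there exist at least two
`(q − 6)`-dimensional lens spaces with fundamental groups of order `q` which are isospectral but not isometric" — here: `q = 2n + 7`
and two weight systems `p, s ∈ Ĩ₀(q, n + 1)` (lens spaces `L(q : p)`, `L(q : s) = S^{2n+1}/ℤ_q` of dimension `2n + 1 = q − 6`) with
`dim E_m(L(q : p)) = dim E_m(L(q : s))` for every `m` (row g44-#3, THEOREM 3.1 (i): all of `𝓛̃₀(q, q₀ − 2)` is mutually isospectral)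
which are NOT equivalent in the sense of Theorem 2.1 (4) — hence, by Theorem 2.1, neither isometric nor diffeomorphic nor
homeomorphic. The two systems are the complements of `(1, 2)` and `(1, 3) ∈ Ĩ₀(q, 2)`; the tree had this only for `q = 11, 13`
(rows g44-#3/#4: `L(11 : 1, 2, 4)`/`L(11 : 1, 2, 8)` and the `13`-examples). [cite: Ikeda1980, Theorem 3.1 (i) and its proof (p. 311),
Theorem 2.1, Remark after Theorem 3.1 ("these lens spaces … are neither diffeomorphic nor homeomorphic to each other")] -/
theorem exists_isospectral_not_lensWeightsEquivalent (hq11 : 11 ≤ q) :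
    ∃ n : ℕ, q = 2 * n + 7 ∧ ∃ p s : Fin (n + 1) → ℤ, IsIkedaWeights q p ∧ IsIkedaWeights q s ∧
      (∀ m, lensSpaceMultiplicity q p m = lensSpaceMultiplicity q s m) ∧ ¬LensWeightsEquivalent q p s := by
  have hq2 : q ≠ 2 := by omega
  obtain ⟨h, hh⟩ : Odd q := hq.out.odd_of_ne_two hq2
  obtain ⟨n, rfl⟩ : ∃ n, h = n + 3 := ⟨h - 3, by omega⟩
  refine ⟨n, by omega, ?_⟩
  obtain ⟨ω, hω⟩ := (isIkedaWeights_one_two (q := q) (by omega)).exists_append (h := n + 3) (k := n + 1) (by omega) (by omega)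
  obtain ⟨ω', hω'⟩ := (isIkedaWeights_one_three (q := q) (by omega)).exists_append (h := n + 3) (k := n + 1) (by omega) (by omega)
  refine ⟨ω, ω', hω.append_right, hω'.append_right, fun m ↦ ?_, fun heq ↦ ?_⟩
  · exact IsIkedaWeights.lensSpaceMultiplicity_eq_of_eq_two_mul_add_seven (by omega) hω.append_right hω'.append_right m
  · exact not_lensWeightsEquivalent_one_two_one_three hq11
      (LensWeightsEquivalent.of_append hq2 (h := n + 3) (by omega) (by omega) hω hω' heq)

end Literature.Analysis.InnerProduct
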